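import Summits.CriticalPhenomena.PercolationContinuityZ3.Theorems.PercNearOneGluingNoHeavyLowerTailSahiHittingSlotWeights

/-!
# `NoHeavyLowerTail` (crux stmt-CriticalPhenomena-4575): KAHN'S CONJECTURE 5 / SAHI'S `C₃` FOR (HITTING EVENT, ARBITRARY, ARBITRARY)

Support file (cell `prim-l12`, seat P3 = Ahlswede–Daykin / four functions, gen 3; `--supports stmt-CriticalPhenomena-4575`).
No `sorry`, no named facts, standard axioms.  New mathematics, not in print.

**THEOREM (`sahiE_three_hit_nonneg`, law form `prodBernoulli_sahiE3_hit_nonneg`).**  For every finite index type `ι`, every product weight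
`μ_p` on `2^ι`, every finite `A ⊆ ι` and ALL increasing events `U, V ⊆ 2^ι`:
  `E₃(1_{H_A}, 1_U, 1_V) ≥ 0`,   `H_A = {ω | ∃ a ∈ A, a ∈ ω}` (the HITTING event: some coordinate of `A` is open).
Kahn's Conjecture 5 [Kahn2022, Conj. 5] = Sahi's `C₃` for product measures [Sahi2008, Conj. 5] asks this for three arbitrary increasing
events; the tree has it when one slot is a CYLINDER (`…SahiCombStrata`), on cubes of dimension `≤ 4` (`…SahiC3CombCubeFour`), for three hitting
events (`…SahiE3HittingEvents`), and on further strata (P-class, junta, substitution, domination, disjunctive closure — all of which restrict the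
other two slots).  Here the first slot is a hitting event (a union of one-coordinate cylinders; `|A| = 1` is the cylinder case) and the other two
are UNRESTRICTED increasing events — the "(hit, arb, arb)" target left open in `…SahiE3HittingEvents`.

PROOF (a two-copy Harris certificate read on the local `A`-configuration; found by an LP over the finite poset of local configurations and
verified there exactly for `|A| ≤ 3`, then proved in general):
1. BLOCK FUBINI (`sahiE_three_hit_eq_sum_gfun`): with `loc_ω X` the section of `X` over the outside configuration `ω ∖ A`,
   `E₃ = Σ_{ω,ω'} w(ω)w(ω') G(ω,ω')`, `G(ω,ω') = 2μ(H U_ωV_ω) − θμ(U_ωV_ω) − μU_ω·μ(H V_{ω'}) − μV_ω·μ(H U_{ω'}) + θ μU_ω μV_{ω'}`, `θ = 1 − dlt`.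
2. TWO-CONFIGURATION LEMMA (`two_config`, pointwise in `(ω,ω')`): `G(ω,ω') + G(ω',ω) ≥ E_ζ[Wt(ζ)(1_{U_ω}−1_{U_{ω'}})(ζ)(1_{V_ω}−1_{V_{ω'}})(ζ)]`
   — sixteen cases on which of the four local events contain `∅` (`two_config_real`, each closed by `linarith`), fed by Harris on the cube, the
   covariance lemma `Cov(X,Z) ≥ dlt(1 − Π_{a∈I}(1−p_a))` (`…Prelim`) and the first-open bounds (`…Weights`).
3. HARRIS on the outside configuration for each fixed `A`-part `ζ` (`BHK2006.harris`): `Σ_{ω,ω'} w w' (u_ζ(ω)−u_ζ(ω'))(v_ζ(ω)−v_ζ(ω')) =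
   2 Cov_ω(u_ζ,v_ζ) ≥ 0`, and `Wt ≥ 0`.  Hence `2E₃ ≥ Σ_ζ w(ζ)Wt(ζ)·2Cov_ω ≥ 0`.
Companion identity (any probability space, recorded in the seat memo, not needed here): `E₃(H,U,V) = μH·{Cov(U,V|H) + μHᶜ[μ(UV|H) − μ(UV|Hᶜ)] +
(μHᶜ)²(μ(U|H)−μ(U|Hᶜ))(μ(V|H)−μ(V|Hᶜ))}` — Kahn's conjecture is a lower bound on the conditional covariance given an increasing event.
[cite: Kahn2022, Conj. 5 (arXiv p. 3); Sahi2008, Conj. 5; LiebSahi2021, eq. (2.1)]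
-/

noncomputable section

open scoped Classical

namespace Summit.CriticalPhenomena.PercolationContinuityZ3.Theorems

namespace SahiHittingSlot

open Finset
open Literature.Combinatorics.Sahi2008
open Literature.Probability.Percolation (DeterminedBy determinedBy_iff)
open SahiCombTensor (sum_bernoulliWeight_inter_eq)
open Literature.Probability.Percolation.BHK2006 (weight weight_nonneg harris harris_anti_anti blockFubini ind_inter ind_mono ind_le_one)
open Literature.Probability.Percolation.DecisionTree (ind ind_of_mem ind_of_not_mem ind_nonneg)

variable {ι : Type} [Fintype ι]

section Ordered

variable [LinearOrder ι]

/-! ### The two-configuration lemma -/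

omit [Fintype ι] [LinearOrder ι] in
/-- The sixteen-case real-arithmetic core of the two-configuration lemma (flags `b, c ∈ {0,1}` record whether `∅` lies in
`U₁, V₁, U₂, V₂`; every hypothesis is an unconditional flag-weighted identity or inequality; each case closes by `linarith`).
[this work] -/
theorem two_config_real
    {d S b₁ c₁ b₂ c₂ mU₁ mV₁ mU₂ mV₂ C12 C21 sU₁ sV₁ sU₂ sV₂ s11 s22 s12 s21 : ℝ}
    (_hd0 : 0 ≤ d) (_hd1 : d ≤ 1) (_hS : S = d * (1 - d))
    (hb₁ : b₁ = 0 ∨ b₁ = 1) (hc₁ : c₁ = 0 ∨ c₁ = 1) (hb₂ : b₂ = 0 ∨ b₂ = 1) (hc₂ : c₂ = 0 ∨ c₂ = 1)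
    (_hmU₁ : 0 ≤ mU₁) (_hmV₁ : 0 ≤ mV₁) (_hmU₂ : 0 ≤ mU₂) (_hmV₂ : 0 ≤ mV₂)
    (_hC12 : 0 ≤ C12) (_hC21 : 0 ≤ C21)
    (_hCs12 : (1 - b₁) * (1 - c₂) * s12 ≤ (1 + d) * C12)
    (_hCs21 : (1 - b₂) * (1 - c₁) * s21 ≤ (1 + d) * C21)
    (_hsU₁ : sU₁ ≤ d * mU₁) (_hsV₁ : sV₁ ≤ d * mV₁) (_hsU₂ : sU₂ ≤ d * mU₂) (_hsV₂ : sV₂ ≤ d * mV₂)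
    (_hsU₁0 : 0 ≤ sU₁) (_hsV₁0 : 0 ≤ sV₁) (_hsU₂0 : 0 ≤ sU₂) (_hsV₂0 : 0 ≤ sV₂)
    (_hs110 : 0 ≤ s11) (_hs220 : 0 ≤ s22) (_hs120 : 0 ≤ s12) (_hs210 : 0 ≤ s21)
    (_fb₁m : b₁ * mU₁ = b₁) (_fb₁dm : b₁ * (d * mU₁) = b₁ * d) (_fb₁s11 : b₁ * s11 = b₁ * sV₁)
    (_fb₁s12 : b₁ * s12 = b₁ * sV₂) (_fb₁s : b₁ * sU₁ = b₁ * S)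
    (_fc₁m : c₁ * mV₁ = c₁) (_fc₁dm : c₁ * (d * mV₁) = c₁ * d) (_fc₁s11 : c₁ * s11 = c₁ * sU₁)
    (_fc₁s21 : c₁ * s21 = c₁ * sU₂) (_fc₁s : c₁ * sV₁ = c₁ * S)
    (_fb₂m : b₂ * mU₂ = b₂) (_fb₂dm : b₂ * (d * mU₂) = b₂ * d) (_fb₂s22 : b₂ * s22 = b₂ * sV₂)
    (_fb₂s21 : b₂ * s21 = b₂ * sV₁) (_fb₂s : b₂ * sU₂ = b₂ * S)
    (_fc₂m : c₂ * mV₂ = c₂) (_fc₂dm : c₂ * (d * mV₂) = c₂ * d) (_fc₂s22 : c₂ * s22 = c₂ * sU₂)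
    (_fc₂s12 : c₂ * s12 = c₂ * sU₁) (_fc₂s : c₂ * sV₂ = c₂ * S) :
    0 ≤ (1 + d) * (C12 + C21) + s11 + s22 - s12 - s21
        + d * ((1 + d) * ((b₁ - b₂) * (c₁ - c₂)) - 2 * (b₁ * c₁ + b₂ * c₂) + c₂ * mU₁ + b₁ * mV₂ + c₁ * mU₂ + b₂ * mV₁) := by
  rcases hb₁ with rfl | rfl <;> rcases hc₁ with rfl | rfl <;> rcases hb₂ with rfl | rfl <;> rcases hc₂ with rfl | rfl <;>
    linarith

omit [Fintype ι] [LinearOrder ι] in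
/-- `1_X(∅) ∈ {0,1}`. [folklore] -/
theorem ind_empty_zero_or_one (X : Set (Set ι)) : ind X (∅ : Set ι) = 0 ∨ ind X (∅ : Set ι) = 1 := by
  by_cases h : (∅ : Set ι) ∈ X
  · exact Or.inr (ind_of_mem h)
  · exact Or.inl (ind_of_not_mem h)

omit [Fintype ι] [LinearOrder ι] in
/-- Flag identities: if `∅ ∈ X` for an increasing `X` then `X = univ`, so every functional of `X` equals its value at `univ`;
packaged as `1_X(∅)·F(X) = 1_X(∅)·F(univ)`. [folklore] -/
theorem flag_mul_eq {X : Set (Set ι)} (hU : IsUpperSet X) (F : Set (Set ι) → ℝ) :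
    ind X ∅ * F X = ind X ∅ * F Set.univ := by
  by_cases h : (∅ : Set ι) ∈ X
  · rw [eq_univ_of_empty_mem hU h]
  · rw [ind_of_not_mem h, zero_mul, zero_mul]

omit [LinearOrder ι] in
/-- Harris for two increasing events under the product weight: `μ(X ∩ Z) ≥ μ(X)μ(Z)`. [folklore] -/
theorem cov_nonneg (p : ι → unitInterval) {X Z : Set (Set ι)} (hX : IsUpperSet X) (hZ : IsUpperSet Z) :
    0 ≤ pr p (X ∩ Z) - pr p X * pr p Z := by
  have h := harris (w := fun e => (p e : ℝ)) (p_nonneg p) (p_le_one p) (ind_nonneg X) (ind_nonneg Z)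
    (monotone_ind_of_isUpperSet hX) (monotone_ind_of_isUpperSet hZ)
  rw [show (∑ ω, weight (fun e => (p e : ℝ)) ω) = 1 from sum_bernoulliWeight p, one_mul] at h
  have h' : ∑ ω, bernoulliWeight p ω * (ind X ω * ind Z ω) = pr p (X ∩ Z) := by
    rw [pr_eq_sum]; exact sum_congr rfl fun ω _ => by rw [ind_inter]
  rw [← h', pr_eq_sum, pr_eq_sum]
  linarith

/-- **THE TWO-CONFIGURATION LEMMA.**  For increasing `A`-determined `U₁, V₁, U₂, V₂`:
`E_ζ[Wt(ζ)·(1_{U₁}−1_{U₂})(ζ)·(1_{V₁}−1_{V₂})(ζ)] ≤ g(U₁,V₁;U₂,V₂) + g(U₂,V₂;U₁,V₁)`.  (Pointwise positivity of the two-copy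
remainder of the Harris certificate; 16 cases on which of the four events contain `∅`, fed by `sTwo_le_cov`, `sOne_le`, Harris.)
[this work] -/
theorem two_config (A : Finset ι) (p : ι → unitInterval) {U₁ V₁ U₂ V₂ : Set (Set ι)}
    (hU₁d : DeterminedBy U₁ (↑A : Set ι)) (hV₁d : DeterminedBy V₁ (↑A : Set ι))
    (hU₂d : DeterminedBy U₂ (↑A : Set ι)) (hV₂d : DeterminedBy V₂ (↑A : Set ι))
    (hU₁ : IsUpperSet U₁) (hV₁ : IsUpperSet V₁) (hU₂ : IsUpperSet U₂) (hV₂ : IsUpperSet V₂) :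
    ∑ ζ, bernoulliWeight p ζ * (Wt A p ζ * ((ind U₁ ζ - ind U₂ ζ) * (ind V₁ ζ - ind V₂ ζ))) ≤
      gfun A p U₁ V₁ U₂ V₂ + gfun A p U₂ V₂ U₁ V₁ := by
  -- expand the left-hand side into four `ex_Wt_mul` terms
  have hsplit : ∑ ζ, bernoulliWeight p ζ * (Wt A p ζ * ((ind U₁ ζ - ind U₂ ζ) * (ind V₁ ζ - ind V₂ ζ))) =
      ∑ ζ, bernoulliWeight p ζ * (Wt A p ζ * (ind U₁ ζ * ind V₁ ζ))
      - ∑ ζ, bernoulliWeight p ζ * (Wt A p ζ * (ind U₁ ζ * ind V₂ ζ))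
      - ∑ ζ, bernoulliWeight p ζ * (Wt A p ζ * (ind U₂ ζ * ind V₁ ζ))
      + ∑ ζ, bernoulliWeight p ζ * (Wt A p ζ * (ind U₂ ζ * ind V₂ ζ)) := by
    rw [← sum_sub_distrib, ← sum_sub_distrib, ← sum_add_distrib]
    exact sum_congr rfl fun ζ _ => by ring
  rw [hsplit, ex_Wt_mul A p hU₁d hV₁d, ex_Wt_mul A p hU₁d hV₂d, ex_Wt_mul A p hU₂d hV₁d, ex_Wt_mul A p hU₂d hV₂d]
  simp only [gfun]
  rw [pr_hit_inter p (determinedBy_inter hU₁d hV₁d) (hU₁.inter hV₁), pr_hit_inter p (determinedBy_inter hU₂d hV₂d) (hU₂.inter hV₂),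
    pr_hit_inter p hV₂d hV₂, pr_hit_inter p hU₂d hU₂, pr_hit_inter p hV₁d hV₁, pr_hit_inter p hU₁d hU₁,
    show ind (U₁ ∩ V₁) (∅ : Set ι) = ind U₁ ∅ * ind V₁ ∅ from ind_inter U₁ V₁ ∅,
    show ind (U₂ ∩ V₂) (∅ : Set ι) = ind U₂ ∅ * ind V₂ ∅ from ind_inter U₂ V₂ ∅]
  -- the real-arithmetic core
  have key := two_config_real (d := dlt A p) (S := dlt A p * (1 - dlt A p))
    (b₁ := ind U₁ ∅) (c₁ := ind V₁ ∅) (b₂ := ind U₂ ∅) (c₂ := ind V₂ ∅)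
    (mU₁ := pr p U₁) (mV₁ := pr p V₁) (mU₂ := pr p U₂) (mV₂ := pr p V₂)
    (C12 := pr p (U₁ ∩ V₂) - pr p U₁ * pr p V₂) (C21 := pr p (U₂ ∩ V₁) - pr p U₂ * pr p V₁)
    (sU₁ := sOne A p U₁) (sV₁ := sOne A p V₁) (sU₂ := sOne A p U₂) (sV₂ := sOne A p V₂)
    (s11 := sTwo A p U₁ V₁) (s22 := sTwo A p U₂ V₂) (s12 := sTwo A p U₁ V₂) (s21 := sTwo A p U₂ V₁)
    (dlt_nonneg A p) (dlt_le_one A p) rfl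
    (ind_empty_zero_or_one U₁) (ind_empty_zero_or_one V₁) (ind_empty_zero_or_one U₂) (ind_empty_zero_or_one V₂)
    (pr_nonneg p U₁) (pr_nonneg p V₁) (pr_nonneg p U₂) (pr_nonneg p V₂)
    (cov_nonneg p hU₁ hV₂) (cov_nonneg p hU₂ hV₁)
    ?_ ?_
    (sOne_le A p hU₁) (sOne_le A p hV₁) (sOne_le A p hU₂) (sOne_le A p hV₂)
    ?_ ?_ ?_ ?_
    (sTwo_nonneg A p U₁ V₁) (sTwo_nonneg A p U₂ V₂) (sTwo_nonneg A p U₁ V₂) (sTwo_nonneg A p U₂ V₁)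
    ?_ ?_ ?_ ?_ ?_  ?_ ?_ ?_ ?_ ?_  ?_ ?_ ?_ ?_ ?_  ?_ ?_ ?_ ?_ ?_
  · linarith [key]
  -- hCs12
  · by_cases h1 : (∅ : Set ι) ∈ U₁
    · rw [ind_of_mem h1]; have := cov_nonneg p hU₁ hV₂; nlinarith [dlt_nonneg A p]
    by_cases h2 : (∅ : Set ι) ∈ V₂
    · rw [ind_of_mem h2]; have := cov_nonneg p hU₁ hV₂; nlinarith [dlt_nonneg A p]
    rw [ind_of_not_mem h1, ind_of_not_mem h2]
    have := sTwo_le_cov A p hU₁d hV₂d hU₁ hV₂ h1 h2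
    linarith
  -- hCs21
  · by_cases h1 : (∅ : Set ι) ∈ U₂
    · rw [ind_of_mem h1]; have := cov_nonneg p hU₂ hV₁; nlinarith [dlt_nonneg A p]
    by_cases h2 : (∅ : Set ι) ∈ V₁
    · rw [ind_of_mem h2]; have := cov_nonneg p hU₂ hV₁; nlinarith [dlt_nonneg A p]
    rw [ind_of_not_mem h1, ind_of_not_mem h2]
    have := sTwo_le_cov A p hU₂d hV₁d hU₂ hV₁ h1 h2
    linarith
  -- sOne ≥ 0
  · rw [← sTwo_self]; exact sTwo_nonneg A p U₁ U₁
  · rw [← sTwo_self]; exact sTwo_nonneg A p V₁ V₁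
  · rw [← sTwo_self]; exact sTwo_nonneg A p U₂ U₂
  · rw [← sTwo_self]; exact sTwo_nonneg A p V₂ V₂
  -- flag identities U₁
  · have := flag_mul_eq hU₁ (fun X => pr p X); rwa [pr_univ, mul_one] at this
  · have := flag_mul_eq hU₁ (fun X => dlt A p * pr p X); rwa [pr_univ, mul_one] at this
  · have := flag_mul_eq hU₁ (fun X => sTwo A p X V₁); rwa [sTwo_univ_left] at this
  · have := flag_mul_eq hU₁ (fun X => sTwo A p X V₂); rwa [sTwo_univ_left] at this
  · have := flag_mul_eq hU₁ (fun X => sOne A p X); rwa [sOne_univ] at this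
  -- V₁
  · have := flag_mul_eq hV₁ (fun X => pr p X); rwa [pr_univ, mul_one] at this
  · have := flag_mul_eq hV₁ (fun X => dlt A p * pr p X); rwa [pr_univ, mul_one] at this
  · have := flag_mul_eq hV₁ (fun X => sTwo A p U₁ X); rwa [sTwo_comm A p U₁ Set.univ, sTwo_univ_left] at this
  · have := flag_mul_eq hV₁ (fun X => sTwo A p U₂ X); rwa [sTwo_comm A p U₂ Set.univ, sTwo_univ_left] at this
  · have := flag_mul_eq hV₁ (fun X => sOne A p X); rwa [sOne_univ] at this
  -- U₂
  · have := flag_mul_eq hU₂ (fun X => pr p X); rwa [pr_univ, mul_one] at this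
  · have := flag_mul_eq hU₂ (fun X => dlt A p * pr p X); rwa [pr_univ, mul_one] at this
  · have := flag_mul_eq hU₂ (fun X => sTwo A p X V₂); rwa [sTwo_univ_left] at this
  · have := flag_mul_eq hU₂ (fun X => sTwo A p X V₁); rwa [sTwo_univ_left] at this
  · have := flag_mul_eq hU₂ (fun X => sOne A p X); rwa [sOne_univ] at this
  -- V₂
  · have := flag_mul_eq hV₂ (fun X => pr p X); rwa [pr_univ, mul_one] at this
  · have := flag_mul_eq hV₂ (fun X => dlt A p * pr p X); rwa [pr_univ, mul_one] at this
  · have := flag_mul_eq hV₂ (fun X => sTwo A p U₂ X); rwa [sTwo_comm A p U₂ Set.univ, sTwo_univ_left] at this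
  · have := flag_mul_eq hV₂ (fun X => sTwo A p U₁ X); rwa [sTwo_comm A p U₁ Set.univ, sTwo_univ_left] at this
  · have := flag_mul_eq hV₂ (fun X => sOne A p X); rwa [sOne_univ] at this

end Ordered

/-! ### The main theorem -/

section MainOrdered

variable [LinearOrder ι]

omit [LinearOrder ι] in
/-- Two-copy form of `E₃(1_H,1_U,1_V)`, `H = hit A`: with `G(ω,ω') = gfun(loc_ω U, loc_ω V; loc_{ω'} U, loc_{ω'} V)`,
`E₃ = Σ_{ω,ω'} w(ω)w(ω') G(ω,ω')`. [this work] -/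
theorem sahiE_three_hit_eq_sum_gfun (p : ι → unitInterval) (A : Finset ι) (U V : Set (Set ι)) :
    sahiE (bernoulliWeight p) 3 ![ind (hit A), ind U, ind V] =
      ∑ ω, ∑ ω', bernoulliWeight p ω * bernoulliWeight p ω' *
        gfun A p (loc A ω U) (loc A ω V) (loc A ω' U) (loc A ω' V) := by
  have hprod : ∀ X Y : Set (Set ι), ind X * ind Y = ind (X ∩ Y) := fun X Y => funext fun ω => (ind_inter X Y ω).symm
  rw [sahiE_three]
  simp only [hprod]
  change 2 * pr p (hit A ∩ U ∩ V) + pr p (hit A) * pr p U * pr p V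
      - (pr p (hit A) * pr p (U ∩ V) + pr p U * pr p (hit A ∩ V) + pr p V * pr p (hit A ∩ U)) = _
  have hone := sum_bernoulliWeight p
  -- expand the right-hand side
  simp only [gfun_loc]
  have hsplit : ∀ ω ω', bernoulliWeight p ω * bernoulliWeight p ω' *
      (2 * pr p (loc A ω (hit A ∩ (U ∩ V))) - (1 - dlt A p) * pr p (loc A ω (U ∩ V))
        - pr p (loc A ω U) * pr p (loc A ω' (hit A ∩ V)) - pr p (loc A ω V) * pr p (loc A ω' (hit A ∩ U))
        + (1 - dlt A p) * (pr p (loc A ω U) * pr p (loc A ω' V)))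
      = (2 * (bernoulliWeight p ω * pr p (loc A ω (hit A ∩ (U ∩ V))))
          - (1 - dlt A p) * (bernoulliWeight p ω * pr p (loc A ω (U ∩ V)))) * bernoulliWeight p ω'
        - (bernoulliWeight p ω * pr p (loc A ω U)) * (bernoulliWeight p ω' * pr p (loc A ω' (hit A ∩ V)))
        - (bernoulliWeight p ω * pr p (loc A ω V)) * (bernoulliWeight p ω' * pr p (loc A ω' (hit A ∩ U)))
        + (1 - dlt A p) * ((bernoulliWeight p ω * pr p (loc A ω U)) * (bernoulliWeight p ω' * pr p (loc A ω' V))) :=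
    fun ω ω' => by ring
  have hrow : ∀ ω, ∑ ω', bernoulliWeight p ω * bernoulliWeight p ω' *
      (2 * pr p (loc A ω (hit A ∩ (U ∩ V))) - (1 - dlt A p) * pr p (loc A ω (U ∩ V))
        - pr p (loc A ω U) * pr p (loc A ω' (hit A ∩ V)) - pr p (loc A ω V) * pr p (loc A ω' (hit A ∩ U))
        + (1 - dlt A p) * (pr p (loc A ω U) * pr p (loc A ω' V)))
      = (2 * (bernoulliWeight p ω * pr p (loc A ω (hit A ∩ (U ∩ V))))
          - (1 - dlt A p) * (bernoulliWeight p ω * pr p (loc A ω (U ∩ V))))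
        - (bernoulliWeight p ω * pr p (loc A ω U)) * pr p (hit A ∩ V)
        - (bernoulliWeight p ω * pr p (loc A ω V)) * pr p (hit A ∩ U)
        + (1 - dlt A p) * ((bernoulliWeight p ω * pr p (loc A ω U)) * pr p V) := by
    intro ω
    rw [sum_congr rfl fun ω' _ => hsplit ω ω', sum_add_distrib, sum_sub_distrib, sum_sub_distrib]
    simp only [← mul_sum]
    rw [hone, mul_one, ← pr_eq_sum_loc, ← pr_eq_sum_loc, ← pr_eq_sum_loc]
  rw [sum_congr rfl fun ω _ => hrow ω, sum_add_distrib, sum_sub_distrib, sum_sub_distrib, sum_sub_distrib]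
  simp only [← mul_sum, ← sum_mul]
  rw [← pr_eq_sum_loc, ← pr_eq_sum_loc, ← pr_eq_sum_loc, ← pr_eq_sum_loc, pr_hit, Set.inter_assoc]
  ring

/-- **Kahn's Conjecture 5 / Sahi's `C₃` for the triple (HITTING EVENT, ARBITRARY, ARBITRARY)** — ordered-index form.
For every finite cube with a product weight, every finite `A` and all increasing `U, V`:
`E₃(1_{hit A}, 1_U, 1_V) ≥ 0`.  Proof: two-copy representation, the pointwise two-configuration lemma, and Harris on the outside
configuration for each fixed `A`-part. [this work] -/
theorem sahiE_three_hit_nonneg_ordered (p : ι → unitInterval) (A : Finset ι) {U V : Set (Set ι)}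
    (hU : IsUpperSet U) (hV : IsUpperSet V) :
    0 ≤ sahiE (bernoulliWeight p) 3 ![ind (hit A), ind U, ind V] := by
  have hE := sahiE_three_hit_eq_sum_gfun p A U V
  -- symmetrise the two copies
  have hsymm : ∑ ω, ∑ ω', bernoulliWeight p ω * bernoulliWeight p ω' * gfun A p (loc A ω U) (loc A ω V) (loc A ω' U) (loc A ω' V)
      = ∑ ω, ∑ ω', bernoulliWeight p ω * bernoulliWeight p ω' * gfun A p (loc A ω' U) (loc A ω' V) (loc A ω U) (loc A ω V) := by
    rw [sum_comm]; exact sum_congr rfl fun ω _ => sum_congr rfl fun ω' _ => by ring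
  have h2E : 2 * sahiE (bernoulliWeight p) 3 ![ind (hit A), ind U, ind V] =
      ∑ ω, ∑ ω', bernoulliWeight p ω * bernoulliWeight p ω' *
        (gfun A p (loc A ω U) (loc A ω V) (loc A ω' U) (loc A ω' V) + gfun A p (loc A ω' U) (loc A ω' V) (loc A ω U) (loc A ω V)) := by
    rw [two_mul, hE]
    nth_rw 2 [hsymm]
    rw [← sum_add_distrib]
    refine sum_congr rfl fun ω _ => ?_
    rw [← sum_add_distrib]
    exact sum_congr rfl fun ω' _ => by ring
  -- the pointwise two-configuration bound
  have hK : ∀ ω ω', ∑ ζ, bernoulliWeight p ζ * (Wt A p ζ *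
      ((ind U (Set.ite (↑A : Set ι) ζ ω) - ind U (Set.ite (↑A : Set ι) ζ ω')) *
        (ind V (Set.ite (↑A : Set ι) ζ ω) - ind V (Set.ite (↑A : Set ι) ζ ω')))) ≤
      gfun A p (loc A ω U) (loc A ω V) (loc A ω' U) (loc A ω' V) + gfun A p (loc A ω' U) (loc A ω' V) (loc A ω U) (loc A ω V) := by
    intro ω ω'
    have h := two_config A p (determinedBy_loc A ω U) (determinedBy_loc A ω V) (determinedBy_loc A ω' U) (determinedBy_loc A ω' V)
      (isUpperSet_loc A ω hU) (isUpperSet_loc A ω hV) (isUpperSet_loc A ω' hU) (isUpperSet_loc A ω' hV)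
    simp only [ind_loc] at h
    exact h
  have hsum : ∑ ω, ∑ ω', bernoulliWeight p ω * bernoulliWeight p ω' * ∑ ζ, bernoulliWeight p ζ * (Wt A p ζ *
      ((ind U (Set.ite (↑A : Set ι) ζ ω) - ind U (Set.ite (↑A : Set ι) ζ ω')) *
        (ind V (Set.ite (↑A : Set ι) ζ ω) - ind V (Set.ite (↑A : Set ι) ζ ω')))) ≤
      ∑ ω, ∑ ω', bernoulliWeight p ω * bernoulliWeight p ω' *
        (gfun A p (loc A ω U) (loc A ω V) (loc A ω' U) (loc A ω' V) + gfun A p (loc A ω' U) (loc A ω' V) (loc A ω U) (loc A ω V)) :=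
    sum_le_sum fun ω _ => sum_le_sum fun ω' _ =>
      mul_le_mul_of_nonneg_left (hK ω ω') (mul_nonneg (bw_nonneg p ω) (bw_nonneg p ω'))
  -- the Harris part is nonnegative
  have hH : 0 ≤ ∑ ω, ∑ ω', bernoulliWeight p ω * bernoulliWeight p ω' * ∑ ζ, bernoulliWeight p ζ * (Wt A p ζ *
      ((ind U (Set.ite (↑A : Set ι) ζ ω) - ind U (Set.ite (↑A : Set ι) ζ ω')) *
        (ind V (Set.ite (↑A : Set ι) ζ ω) - ind V (Set.ite (↑A : Set ι) ζ ω')))) := by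
    -- put the `ζ`-sum outside
    have hre : ∑ ω, ∑ ω', bernoulliWeight p ω * bernoulliWeight p ω' * ∑ ζ, bernoulliWeight p ζ * (Wt A p ζ *
        ((ind U (Set.ite (↑A : Set ι) ζ ω) - ind U (Set.ite (↑A : Set ι) ζ ω')) *
          (ind V (Set.ite (↑A : Set ι) ζ ω) - ind V (Set.ite (↑A : Set ι) ζ ω')))) =
        ∑ ζ, bernoulliWeight p ζ * Wt A p ζ * ∑ ω, ∑ ω', bernoulliWeight p ω * bernoulliWeight p ω' *
          ((ind U (Set.ite (↑A : Set ι) ζ ω) - ind U (Set.ite (↑A : Set ι) ζ ω')) *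
            (ind V (Set.ite (↑A : Set ι) ζ ω) - ind V (Set.ite (↑A : Set ι) ζ ω'))) := by
      calc _ = ∑ ω, ∑ ω', ∑ ζ, bernoulliWeight p ω * bernoulliWeight p ω' * (bernoulliWeight p ζ * (Wt A p ζ *
              ((ind U (Set.ite (↑A : Set ι) ζ ω) - ind U (Set.ite (↑A : Set ι) ζ ω')) *
                (ind V (Set.ite (↑A : Set ι) ζ ω) - ind V (Set.ite (↑A : Set ι) ζ ω'))))) := by
            simp only [mul_sum]
        _ = ∑ ω, ∑ ζ, ∑ ω', bernoulliWeight p ω * bernoulliWeight p ω' * (bernoulliWeight p ζ * (Wt A p ζ *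
              ((ind U (Set.ite (↑A : Set ι) ζ ω) - ind U (Set.ite (↑A : Set ι) ζ ω')) *
                (ind V (Set.ite (↑A : Set ι) ζ ω) - ind V (Set.ite (↑A : Set ι) ζ ω'))))) :=
            sum_congr rfl fun ω _ => sum_comm
        _ = ∑ ζ, ∑ ω, ∑ ω', bernoulliWeight p ω * bernoulliWeight p ω' * (bernoulliWeight p ζ * (Wt A p ζ *
              ((ind U (Set.ite (↑A : Set ι) ζ ω) - ind U (Set.ite (↑A : Set ι) ζ ω')) *
                (ind V (Set.ite (↑A : Set ι) ζ ω) - ind V (Set.ite (↑A : Set ι) ζ ω'))))) := sum_comm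
        _ = _ := sum_congr rfl fun ζ _ => by
            rw [mul_sum]
            refine sum_congr rfl fun ω _ => ?_
            rw [mul_sum]
            exact sum_congr rfl fun ω' _ => by ring
    rw [hre]
    refine sum_nonneg fun ζ _ => mul_nonneg (mul_nonneg (bw_nonneg p ζ) (Wt_nonneg A p ζ)) ?_
    -- `Σ_{ω,ω'} w w' (uω − uω')(vω − vω') = 2·Cov_ω(u,v) ≥ 0` by Harris
    have hone := sum_bernoulliWeight p
    set uu : Set ι → ℝ := fun ω => ind U (Set.ite (↑A : Set ι) ζ ω) with huu
    set vv : Set ι → ℝ := fun ω => ind V (Set.ite (↑A : Set ι) ζ ω) with hvv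
    have hcov : ∑ ω, ∑ ω', bernoulliWeight p ω * bernoulliWeight p ω' * ((uu ω - uu ω') * (vv ω - vv ω')) =
        2 * (∑ ω, bernoulliWeight p ω * (uu ω * vv ω) -
          (∑ ω, bernoulliWeight p ω * uu ω) * (∑ ω, bernoulliWeight p ω * vv ω)) := by
      have hsp : ∀ ω ω', bernoulliWeight p ω * bernoulliWeight p ω' * ((uu ω - uu ω') * (vv ω - vv ω')) =
          (bernoulliWeight p ω * (uu ω * vv ω)) * bernoulliWeight p ω' - (bernoulliWeight p ω * uu ω) * (bernoulliWeight p ω' * vv ω')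
            - (bernoulliWeight p ω * vv ω) * (bernoulliWeight p ω' * uu ω') + bernoulliWeight p ω * (bernoulliWeight p ω' * (uu ω' * vv ω')) :=
        fun ω ω' => by ring
      have hrow : ∀ ω, ∑ ω', bernoulliWeight p ω * bernoulliWeight p ω' * ((uu ω - uu ω') * (vv ω - vv ω')) =
          (bernoulliWeight p ω * (uu ω * vv ω)) - (bernoulliWeight p ω * uu ω) * (∑ ω', bernoulliWeight p ω' * vv ω')
            - (bernoulliWeight p ω * vv ω) * (∑ ω', bernoulliWeight p ω' * uu ω')
            + bernoulliWeight p ω * (∑ ω', bernoulliWeight p ω' * (uu ω' * vv ω')) := by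
        intro ω
        rw [sum_congr rfl fun ω' _ => hsp ω ω', sum_add_distrib, sum_sub_distrib, sum_sub_distrib, ← mul_sum, ← mul_sum, ← mul_sum,
          ← mul_sum, hone, mul_one]
      rw [sum_congr rfl fun ω _ => hrow ω, sum_add_distrib, sum_sub_distrib, sum_sub_distrib, ← sum_mul, ← sum_mul, ← sum_mul, hone,
        one_mul]
      ring
    change 0 ≤ ∑ ω, ∑ ω', bernoulliWeight p ω * bernoulliWeight p ω' * ((uu ω - uu ω') * (vv ω - vv ω'))
    rw [hcov]
    have hh := harris (w := fun e => (p e : ℝ)) (p_nonneg p) (p_le_one p)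
      (f := uu) (g := vv) (fun ω => ind_nonneg _ _) (fun ω => ind_nonneg _ _)
      (monotone_ind_ite hU ζ) (monotone_ind_ite hV ζ)
    rw [show (∑ ω, weight (fun e => (p e : ℝ)) ω) = 1 from hone, one_mul] at hh
    change (∑ ω, bernoulliWeight p ω * uu ω) * (∑ ω, bernoulliWeight p ω * vv ω) ≤
      ∑ ω, bernoulliWeight p ω * (uu ω * vv ω) at hh
    linarith
  linarith [hH.trans hsum, h2E]

end MainOrdered

/-- **Kahn's Conjecture 5 / Sahi's `C₃` for the triple (HITTING EVENT, ARBITRARY INCREASING, ARBITRARY INCREASING).**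
For every finite index type `ι`, every product weight `μ_p` on the cube `2^ι`, every finite `A ⊆ ι` and ALL increasing events `U, V`:
  `E₃(1_{H_A}, 1_U, 1_V) ≥ 0`,  `H_A = {ω | ∃ a ∈ A, a ∈ ω}` the hitting event of `A`.
New dimension-free case of Kahn's conjecture (the first slot a union of one-coordinate cylinders, the other two unrestricted); for
`|A| = 1` it is the cylinder case.  [this work] -/
theorem sahiE_three_hit_nonneg (p : ι → unitInterval) (A : Finset ι) {U V : Set (Set ι)}
    (hU : IsUpperSet U) (hV : IsUpperSet V) :
    0 ≤ sahiE (bernoulliWeight p) 3 ![ind {ω : Set ι | ∃ a ∈ A, a ∈ ω}, ind U, ind V] := by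
  letI : LinearOrder ι := LinearOrder.lift' (Fintype.equivFin ι) (Fintype.equivFin ι).injective
  exact sahiE_three_hit_nonneg_ordered p A hU hV

/-- The same statement for the tree's event functional `sahiE3` of the product measure `prodBernoulli p`:
`0 ≤ sahiE3 (prodBernoulli p) H_A U V` for all increasing `U, V`. [this work] -/
theorem prodBernoulli_sahiE3_hit_nonneg (p : ι → unitInterval) (A : Finset ι) {U V : Set (Set ι)}
    (hU : IsUpperSet U) (hV : IsUpperSet V) :
    0 ≤ Literature.Probability.LatticeModels.sahiE3 (Literature.Probability.LatticeModels.prodBernoulli p)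
      {ω : Set ι | ∃ a ∈ A, a ∈ ω} U V := by
  rw [← sahiE_three_ind]; exact sahiE_three_hit_nonneg p A hU hV

end SahiHittingSlot

end Summit.CriticalPhenomena.PercolationContinuityZ3.Theorems
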